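import Summits.BirchSwinnertonDyer.BirchSwinnertonDyer.Theorems.ErratumRoadFiveIMCDivOneSidedNoFiniteSubmoduleFree
import HarnessLib

/-!
# Route `ErratumRoadFive`, crux `IMCDivAtErratumDataAll` (item stmt-BirchSwinnertonDyer-19270), stub S2
# `stub_imcDivErratum_splitAtP`: the congruence input (c) of Road FF read ONE-SIDEDLY — limit lemmas
# and the transfer on `X_ac^Σ(E[p^∞])` with `(L_m) ⊆ (L^Σ) + (p)^m` and `L·P_Σ ∣ L^Σ` (kernel)

Cell `bsd-stepL` (run/shared/lean/pub/bsd-stepL/), PART 1b ACCEL seat `bsd-stepL-imc24b` (prover, row (2),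
session g3); `--supports stmt-BirchSwinnertonDyer-19270 --as helper`. HONEST FRAMING: THEOREMS ONLY (pure
commutative algebra + two theorems on the constructed module `X_ac^Σ(E[p^∞])`); no definition, no named
fact, no `sorry`; nothing is asserted about any curve; the item is NOT closed; BSD is proved for no pair;
X11b stays CONSTRUCTION-SHAPED. The seat's ASSIGNED road (bipartite Euler systems at split `p`) is
CLOSED-NEGATIVE for this crux (g0 ∕ g2: it yields (2.3), not (2.4)); this file works the ONE place where
`a_p = +1` versus `a_p = −1` is read on the LINE OF RECORD (Road FF, owner `bsd-stepL-imc-p1`). Companion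
file `Theorems/ErratumRoadFiveIMCDivPNewSeam.lean` (the seam algebra and the sign dichotomy).

## Why (the sign-sensitive seam of Road FF)

Road FF's descent (erratum p. 4 read one-sidedly; tree: imc24c's
`AcSelmer.XAc.charIdeal_map_toUnr_le_span_of_oneSided_congruences_of_isTorsion`, imc-p1's
`AcSelmer.XAc.map_charIdeal_le_span_of_roadFF_unr_le`, X2's `HidaLimitAlgebra.map_le_span_of_oneSided_congruences`)
consumes the congruence of `p`-adic `L`-functions (c) as an EQUALITY of ideals
`(L_m) + (p)^m = (L^Σ_f) + (p)^m` in `R₀⟦T⟧`, with `L_f` the Cas18-Thm-3.1 frame (`ε_p = 0`, tree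
`R1.IsBDPLFunction[Int]`). Print delivers (c) from the two-variable function: [Cas18, (4.1)]
`L^Σ_p(𝐟) mod ℘̃_φ = L^Σ_p(𝐟_φ)` at `φ = ν_{g_m}` and at the `p`-NEW weight-2 point `φ = ν_f`, plus
`ν_{g_m} ≡ ν_f (mod p^m)`. At `ν_f` the identification `ν_f(L_p(𝐟)) ∼ L_f` is asserted in [Cas18, p. 11]
by reference to «the proof of [Cas20, Thm. 2.11]», whose PRINTED multiplier is the `p`-OLD one,
`𝓔_𝔭 = (1 − a_p p^{-1} φ(𝔭̄))·(1 − φ(𝔭̄)/a_p)` (cell LIT-DOSSIER §20.4, lit g14: «at a_p = +1 and the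
trivial character this factor VANISHES»; the `p`-new multiplier has ONE factor, β_p = 0, [Castella JIMJ
17 (2018), Thm. 2.10]). Read verbatim, the two readings of `ν_f(L_p(𝐟))` differ by the square of the
SEAM `s = 1 − a_p^{-1}·σ_𝔭̄ ∈ R₀⟦T⟧` (`σ_𝔭̄` of constant term `1`): a UNIT at `a_p = −1` (stub S1), an
element of `(T)` — never a unit — at `a_p = +1` (stub S2; companion file). So the equality-typed (c) with
`L := L_f` follows from print at SPLIT `p` ONLY under the `p`-new identification; but the descent uses
only the inclusion `(L_m) ⊆ (L^Σ_f) + (p)^m`, which follows in EITHER reading from the family congruence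
and the divisibility `L^Σ_f ∣ ν_f(L^Σ(𝐟))` (companion file `PNewSeam.span_singleton_le_sup_of_sub_mem_of_dvd`):
an extra non-unit factor on the family side only STRENGTHENS `Ch_Λ(X_ac^∅)·R₀⟦T⟧ ⊆ (ν_f(L)) ⊆ (L_f)`.
This file proves the one-sided-(c) twins of the three limit lemmas (§1) and the one-sided-(c) transfer
on the tree object with the `Σ`-bookkeeping also one-sided, `L·P_Σ ∣ L^Σ` (§3). With them the S2
instance of Road FF needs no `p`-new identification beyond `L^Σ_f ∣ ν_f(L^Σ_p(𝐟))`.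

## Contents

* §1 `CongruenceLe.fittingIdeal_le_span_of_congruences_le` (one ring), `map_fittingIdeal_le_sup_of_congruence_le`,
  **`map_le_span_of_oneSided_congruences_le`** (two rings along `φ : R → S`, X2's shape) and
  `map_fittingIdeal_le_span_of_congruences_le` (along `algebraMap`, imc-p1's shape — no base change
  needed) — each with `hc : (L_m) ⊆ (L) + φ(I)^m` in place of the equality; `span_singleton_le_sup_of_eq`
  (every equality-(c) consumer's hypothesis implies ours).
* §3 **`AcSelmer.XAc.charIdeal_map_toUnr_le_span_of_map_fittingIdeal_le`** (the step
  `Fitt₀(X^Σ)·R₀⟦T⟧ ⊆ (L^Σ) ⟹ Ch(X^∅)·R₀⟦T⟧ ⊆ (L)` of imc24c's proof factored out, with `L·φP_Σ ∣ L^Σ`),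
  **`AcSelmer.XAc.charIdeal_map_toUnr_le_span_of_oneSided_congruences_le`** (imc24c's theorem with
  (c) and the `Σ`-identity both ONE-SIDED) and `AcSelmer.XAc.oneSided_inputs_of_eq` (nothing is lost).

References: [Castella2018Erratum] (c) and proof of Thm. 1.1 (p. 4); [Castella2018] Thm. 3.1, (4.1),
p. 11 L9–11; [Castella2020JIMJ] JIMJ 19, Def. 2.10, Thm. 2.11 (the printed multiplier); [Castella2018Exceptional]
JIMJ 17, Thm. 2.10 (β_p = 0 at a `p`-new form); [Skinner2016PacificMC] §3.1 (p. 192); cell LIT-DOSSIER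
§20.4 (lit g14); [StacksProject] 05GI (Krull), 07ZA; [Washington1997] §13.2.
-/

set_option autoImplicit false

noncomputable section

open scoped Classical

open PowerSeries Literature.NumberTheory.EllipticCurves Literature.NumberTheory.EllipticCurves.Module
  Literature.RingTheory.FittingIdeal NumberField IsDedekindDomain Field
open Summit.BirchSwinnertonDyer.Rank1Residual.X11b.AcSelmer Summit.BirchSwinnertonDyer.Rank1Residual.X11b.Halves
  Summit.BirchSwinnertonDyer.Rank1Residual.X2
open Summit.BirchSwinnertonDyer.BirchSwinnertonDyer.Theorems (exists_span_C_pow_mul_span_le_fittingIdeal_zero)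

namespace Summit.BirchSwinnertonDyer.Rank1Residual.X11b

universe u v

/-! ### §1 The limit lemmas with (c) ONE-SIDED: `(L_m) ⊆ (L) + I^m` -/

namespace CongruenceLe

section OneRing

variable {R : Type u} [CommRing R] (I : Ideal R)
  {M : Type*} [AddCommGroup M] [Module R M] [Module.Finite R M] {L : R}
  (N : ℕ → Type*) [∀ m, AddCommGroup (N m)] [∀ m, Module R (N m)] [∀ m, Module.Finite R (N m)]
  (Lm : ℕ → R)

/-- Every EQUALITY-(c) hypothesis of the tree's consumers implies the one-sided one used here:
`(a) + J = (b) + J ⟹ (a) ⊆ (b) + J`. [folklore] -/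
theorem span_singleton_le_sup_of_eq {a b : R} {J : Ideal R}
    (h : Ideal.span {a} ⊔ J = Ideal.span {b} ⊔ J) : Ideal.span {a} ≤ Ideal.span {b} ⊔ J :=
  le_sup_left.trans h.le

/-- **(Fitt-L-≤) modulo `I^m`, (c) one-sided.** From `e : M/I^m ≅ N_m/I^m`, `Fitt₀(N_m) ⊆ (L_m)` and
`(L_m) ⊆ (L) + I^m`: `Fitt₀(M) + I^m ⊆ (L) + I^m`. Twin of
`CongruenceLimit.fittingIdeal_sup_pow_le_of_congruences` (which takes `(L_m) + I^m = (L) + I^m`).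
[cite: Castella2018Erratum, proof of Thm. 1.1 (p. 4), display, one inclusion] -/
theorem fittingIdeal_sup_pow_le_of_congruences_le
    (e : ∀ m : ℕ, 1 ≤ m →
      ((M ⧸ (I ^ m • (⊤ : Submodule R M))) ≃ₗ[R] (N m ⧸ (I ^ m • (⊤ : Submodule R (N m))))))
    (hF : ∀ m : ℕ, 1 ≤ m → Module.fittingIdeal R (N m) 0 ≤ Ideal.span {Lm m})
    (hc : ∀ m : ℕ, 1 ≤ m → Ideal.span {Lm m} ≤ Ideal.span {L} ⊔ I ^ m)
    (m : ℕ) (hm : 1 ≤ m) :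
    Module.fittingIdeal R M 0 ⊔ I ^ m ≤ Ideal.span {L} ⊔ I ^ m := by
  rw [CongruenceLimit.fittingIdeal_sup_eq_of_quotEquiv (I ^ m) (e m hm) 0]
  exact sup_le ((hF m hm).trans (hc m hm)) le_sup_right

/-- **The one-sided congruence limit, (c) one-sided** (one ring `R`, Noetherian, `I ⊆ Jac(R)`):
`Fitt₀(M) ⊆ ⋂_m ((L) + I^m) = (L)` (Krull). Twin of `CongruenceLimit.fittingIdeal_le_span_of_congruences`.
[cite: Castella2018Erratum, proof of Thm. 1.1 (p. 4)] [cite: Skinner2016PacificMC, §3.1 (p. 192)] -/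
theorem fittingIdeal_le_span_of_congruences_le [IsNoetherianRing R]
    (hI : I ≤ (⊥ : Ideal R).jacobson)
    (e : ∀ m : ℕ, 1 ≤ m →
      ((M ⧸ (I ^ m • (⊤ : Submodule R M))) ≃ₗ[R] (N m ⧸ (I ^ m • (⊤ : Submodule R (N m))))))
    (hF : ∀ m : ℕ, 1 ≤ m → Module.fittingIdeal R (N m) 0 ≤ Ideal.span {Lm m})
    (hc : ∀ m : ℕ, 1 ≤ m → Ideal.span {Lm m} ≤ Ideal.span {L} ⊔ I ^ m) :
    Module.fittingIdeal R M 0 ≤ Ideal.span {L} := by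
  rw [← CongruenceLimit.iInf_sup_pow_eq_self I (Ideal.span {L}) hI]
  refine le_iInf fun m => ?_
  rcases Nat.eq_zero_or_pos m with rfl | hm
  · rw [pow_zero, Ideal.one_eq_top, sup_top_eq]; exact le_top
  · exact le_sup_left.trans (fittingIdeal_sup_pow_le_of_congruences_le I N Lm e hF hc m hm)

end OneRing

section TwoRingMap

variable {R : Type u} [CommRing R] {S : Type v} [CommRing S] (φ : R →+* S)
  (I : Ideal R) {M : Type*} [AddCommGroup M] [Module R M] [Module.Finite R M]
  (N : ℕ → Type*) [∀ m, AddCommGroup (N m)] [∀ m, Module R (N m)] [∀ m, Module.Finite R (N m)]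

/-- **One step across `φ : R → S`, (c) one-sided**: `φ(Fitt₀(M)) ⊆ (L) + φ(I)^m` from
`e_m : M/I^m ≅ N_m/I^m` over `R`, `φ(Fitt₀(N_m)) ⊆ (L_m)` and `(L_m) ⊆ (L) + φ(I)^m` in `S`. Twin of
`HidaLimitAlgebra.map_fittingIdeal_le_sup_of_congruence` (same proof; only this inclusion of its
equality was ever used). [cite: Skinner2016PacificMC, §3.1 (p. 192)] [cite: Castella2018Erratum, proof of Thm. 1.1 (p. 4)] -/
theorem map_fittingIdeal_le_sup_of_congruence_le {L Lm : S} {m : ℕ}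
    (e : (M ⧸ (I ^ m • (⊤ : Submodule R M))) ≃ₗ[R] (N m ⧸ (I ^ m • (⊤ : Submodule R (N m)))))
    (hF : (Module.fittingIdeal R (N m) 0).map φ ≤ Ideal.span {Lm})
    (hc : Ideal.span {Lm} ≤ Ideal.span {L} ⊔ (I.map φ) ^ m) :
    (Module.fittingIdeal R M 0).map φ ≤ Ideal.span {L} ⊔ (I.map φ) ^ m := by
  have h1 : (Module.fittingIdeal R M 0).map φ ≤ (Module.fittingIdeal R M 0 ⊔ I ^ m).map φ :=
    Ideal.map_mono le_sup_left
  rw [CongruenceLimit.fittingIdeal_sup_eq_of_quotEquiv (I ^ m) e 0, Ideal.map_sup, Ideal.map_pow] at h1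
  exact h1.trans (sup_le (hF.trans hc) le_sup_right)

/-- **The one-sided REVERSE congruence limit across `φ : R → S`, (c) one-sided** (`S` Noetherian,
`φ(I) ⊆ Jac(S)`): `J ⊆ Fitt₀_R(M)`, `M/I^m ≅ N_m/I^m`, `φ(Fitt₀_R(N_m)) ⊆ (L_m)`, `(L_m) ⊆ (L) + φ(I)^m`
⟹ `φ(J) ⊆ (L)`. Twin of X2's `HidaLimitAlgebra.map_le_span_of_oneSided_congruences`.
[cite: Skinner2016PacificMC, §3.1 (p. 192)] [cite: Castella2018Erratum, proof of Thm. 1.1 (p. 4)]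
[cite: StacksProject, Tag 05GI (Krull)] -/
theorem map_le_span_of_oneSided_congruences_le [IsNoetherianRing S]
    (hI : I.map φ ≤ (⊥ : Ideal S).jacobson)
    {J : Ideal R} (hJ : J ≤ Module.fittingIdeal R M 0) (L : S) (Lm : ℕ → S)
    (e : ∀ m : ℕ, 1 ≤ m →
      ((M ⧸ (I ^ m • (⊤ : Submodule R M))) ≃ₗ[R] (N m ⧸ (I ^ m • (⊤ : Submodule R (N m))))))
    (hF : ∀ m : ℕ, 1 ≤ m → (Module.fittingIdeal R (N m) 0).map φ ≤ Ideal.span {Lm m})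
    (hc : ∀ m : ℕ, 1 ≤ m → Ideal.span {Lm m} ≤ Ideal.span {L} ⊔ (I.map φ) ^ m) :
    J.map φ ≤ Ideal.span {L} := by
  refine (Ideal.map_mono hJ).trans ?_
  rw [← CongruenceLimit.iInf_sup_pow_eq_self (I.map φ) (Ideal.span {L}) hI]
  refine le_iInf fun m ↦ ?_
  rcases Nat.eq_zero_or_pos m with rfl | hm
  · rw [pow_zero, Ideal.one_eq_top, sup_top_eq]; exact le_top
  · exact map_fittingIdeal_le_sup_of_congruence_le φ I N (e m hm) (hF m hm) (hc m hm)

end TwoRingMap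

section TwoRingAlg

variable {R : Type u} [CommRing R] (S : Type v) [CommRing S] [Algebra R S]

/-- **Two rings along `algebraMap R S`, (c) one-sided** — the conclusion of imc-p1's
`CongruenceLimit.map_fittingIdeal_le_span_of_congruences` (`Fitt_R(M)·S ⊆ (L)`) from
`hc m : (L_m) ⊆ (L) + (IS)^m`; no base change is needed on this road (the previous lemma with
`φ = algebraMap`, `J = Fitt₀(M)`). Swapping this lemma for that one at the root of the Road-FF chain
(`…TransferTwoRing` → `…TransferDivisibleInvariants` → `…TransferUnrReceptacle[OneSidedSigma]`) makes
every `hc` there one-sided with proofs otherwise unchanged.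
[cite: Castella2018Erratum, proof of Thm. 1.1 (p. 4), read one-sidedly] [cite: Skinner2016PacificMC, §3.1 (p. 192)] -/
theorem map_fittingIdeal_le_span_of_congruences_le [IsNoetherianRing S]
    {M : Type*} [AddCommGroup M] [Module R M] [Module.Finite R M]
    (N : ℕ → Type*) [∀ m, AddCommGroup (N m)] [∀ m, Module R (N m)] [∀ m, Module.Finite R (N m)]
    (I : Ideal R) (hI : I.map (algebraMap R S) ≤ (⊥ : Ideal S).jacobson) {L : S} (Lm : ℕ → S)
    (e : ∀ m : ℕ, 1 ≤ m →
      ((M ⧸ (I ^ m • (⊤ : Submodule R M))) ≃ₗ[R] (N m ⧸ (I ^ m • (⊤ : Submodule R (N m))))))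
    (hF : ∀ m : ℕ, 1 ≤ m →
      (Module.fittingIdeal R (N m) 0).map (algebraMap R S) ≤ Ideal.span {Lm m})
    (hc : ∀ m : ℕ, 1 ≤ m →
      Ideal.span {Lm m} ≤ Ideal.span {L} ⊔ (I.map (algebraMap R S)) ^ m) :
    (Module.fittingIdeal R M 0).map (algebraMap R S) ≤ Ideal.span {L} :=
  map_le_span_of_oneSided_congruences_le (algebraMap R S) I N hI le_rfl L Lm e hF hc

end TwoRingAlg

end CongruenceLe

/-! ### §3 On `X_ac^Σ(E[p^∞])`: the transfer with (c) AND the `Σ`-identity one-sided -/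

section XAc

variable {K : Type} [Field K] [NumberField K] (E : WeierstrassCurve K) [E.IsElliptic]
  (p : ℕ) [Fact p.Prime] (κ : ZpExtension K p) (𝔭 : HeightOneSpectrum (𝓞 K))
  {S : Set (HeightOneSpectrum (𝓞 K))} (γ : Field.absoluteGaloisGroup K) [Fact (κ.IsTopGenerator γ)]

/-- **From `Fitt₀(X^Σ)·R₀⟦T⟧ ⊆ (L^Σ)` to `Ch(X^∅)·R₀⟦T⟧ ⊆ (L)`** — steps (2)–(6) of imc24c's
`AcSelmer.XAc.charIdeal_map_toUnr_le_span_of_oneSided_congruences_of_isTorsion` factored out (adapted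
verbatim, with the `Σ`-identity weakened to the divisibility `L·φ(P_Σ) ∣ L^Σ`, the only half used):
torsion of `X^Σ` gives `(p)^a·Ch(X^Σ), (T)^b·Ch(X^Σ) ⊆ Fitt₀(X^Σ)` (bsd-eis ∕ imc24c), so `L^Σ` divides
`p^a·φF` and `T^b·φF` for a generator `F`; `Σ`-removal at the level of elements; two-prime cancellation
in the UFD `R₀⟦T⟧`. CONDITIONAL on its inputs; nothing asserted about the curve.
[cite: Castella2018Erratum, proof of Thm. 1.1 (p. 4), read one-sidedly] [cite: Washington1997, §13.2] -/
theorem AcSelmer.XAc.charIdeal_map_toUnr_le_span_of_map_fittingIdeal_le (hS : S.Finite)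
    (hT : Module.IsTorsion (IwasawaAlgebra p) (XAc E p κ 𝔭 S γ)) {LS : UnrSeries p}
    (key : (Module.fittingIdeal (IwasawaAlgebra p) (XAc E p κ 𝔭 S γ) 0).map
      (PowerSeries.map (toUnr p)) ≤ Ideal.span {LS})
    {PS : IwasawaAlgebra p} (hPS : PS ≠ 0)
    (hX : XAc.charIdeal E p κ 𝔭 ∅ γ * Ideal.span {PS} ≤ XAc.charIdeal E p κ 𝔭 S γ)
    {L : UnrSeries p} (hLS : L * PowerSeries.map (toUnr p) PS ∣ LS) :
    (XAc.charIdeal E p κ 𝔭 ∅ γ).map (PowerSeries.map (toUnr p)) ≤ Ideal.span {L} := by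
  -- adapted from Theorems/ErratumRoadFiveIMCDivOneSidedNoFiniteSubmoduleFree.lean (imc24c), steps (2)–(6)
  set φ : IwasawaAlgebra p →+* UnrSeries p := PowerSeries.map (toUnr p) with hφ
  haveI : Module.Finite (IwasawaAlgebra p) (XAc E p κ 𝔭 S γ) := XAc.module_finite κ 𝔭 S γ hS
  haveI := HidaLimitAlgebra.isNoetherianRing_unrSeries (p := p)
  haveI := HidaLimitAlgebra.isDiscreteValuationRing_unrIntegers (p := p)
  obtain ⟨F, hFS⟩ := (charIdeal_isPrincipal_holds p (XAc E p κ 𝔭 S γ)).principal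
  obtain ⟨G, hG0⟩ := (charIdeal_isPrincipal_holds p (XAc E p κ 𝔭 ∅ γ)).principal
  have hFS1 : Module.charIdeal (IwasawaAlgebra p) (XAc E p κ 𝔭 S γ) = Ideal.span {F} := hFS
  have hG1 : XAc.charIdeal E p κ 𝔭 ∅ γ = Ideal.span {G} := hG0
  have hFS2 : XAc.charIdeal E p κ 𝔭 S γ = Ideal.span {F} := hFS
  obtain ⟨a, ha⟩ := exists_span_C_pow_mul_span_le_fittingIdeal_zero (XAc E p κ 𝔭 S γ) hT hFS1
  obtain ⟨b, hb⟩ :=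
    CongruenceDescent.exists_span_X_pow_mul_span_le_fittingIdeal_zero (XAc E p κ 𝔭 S γ) hT hFS1
  have memS : ∀ {x : IwasawaAlgebra p} {n : ℕ},
      Ideal.span {x} ^ n * Ideal.span {F} ≤
        Module.fittingIdeal (IwasawaAlgebra p) (XAc E p κ 𝔭 S γ) 0 → LS ∣ φ x ^ n * φ F := by
    intro x n hle
    have hmem : x ^ n * F ∈ Ideal.span {x} ^ n * Ideal.span {F} := by
      rw [Ideal.span_singleton_pow]
      exact Ideal.mul_mem_mul (Ideal.mem_span_singleton_self _) (Ideal.mem_span_singleton_self _)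
    have h := key (Ideal.mem_map_of_mem φ (hle hmem))
    rw [map_mul, map_pow] at h
    exact Ideal.mem_span_singleton.mp h
  have hpa : LS ∣ (C ((p : ℕ) : unrIntegers p) : UnrSeries p) ^ a * φ F := by
    have h := memS ha
    rwa [hφ, PowerSeries.map_C, map_natCast] at h
  have hTb : LS ∣ (X : UnrSeries p) ^ b * φ F := by
    have h := memS hb
    rwa [hφ, PowerSeries.map_X] at h
  have hFG : φ F ∣ φ G * φ PS := by
    rw [← map_mul]
    refine map_dvd φ (Ideal.mem_span_singleton.mp ?_)
    rw [← hFS2]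
    refine hX ?_
    rw [hG1]
    exact Ideal.mul_mem_mul (Ideal.mem_span_singleton_self G) (Ideal.mem_span_singleton_self PS)
  have hPS' : φ PS ≠ 0 := fun h ↦ hPS (map_toUnr_injective (by rw [← hφ, h, map_zero]))
  have cancel : ∀ {y : UnrSeries p}, LS ∣ y * φ F → L ∣ y * φ G := by
    intro y hy
    have h : L * φ PS ∣ y * φ G * φ PS :=
      calc L * φ PS ∣ LS := hLS
        _ ∣ y * φ F := hy
        _ ∣ y * (φ G * φ PS) := mul_dvd_mul_left y hFG
        _ = y * φ G * φ PS := (mul_assoc _ _ _).symm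
    exact (mul_dvd_mul_iff_right hPS').mp h
  have hL1 : L ∣ (C ((p : ℕ) : unrIntegers p) : UnrSeries p) ^ a * φ G := cancel hpa
  have hL2 : L ∣ (X : UnrSeries p) ^ b * φ G := cancel hTb
  have hLG : L ∣ φ G :=
    CongruenceDescent.dvd_of_dvd_prime_pow_mul_of_dvd_prime_pow_mul
      (prime_C_of_prime CongruenceDescent.prime_natCast_p_unrIntegers)
      CongruenceDescent.not_C_p_dvd_X_unrSeries a b L (φ G) hL1 hL2
  rw [hG1, Ideal.map_span, Set.image_singleton]
  exact Ideal.span_singleton_le_span_singleton.mpr hLG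

/-- **Erratum p. 4 read ONE-SIDEDLY on `X^Σ = X_ac^Σ(E[p^∞])`, torsion only, with (c) ONE-SIDED and the
`Σ`-identity ONE-SIDED** — imc24c's `…_of_oneSided_congruences_of_isTorsion` with
`hc m : (L_m) ⊆ (L^Σ) + (p)^m` (instead of `=`) and `hLS : L·φ(P_Σ) ∣ L^Σ` (instead of
`(L^Σ) = (L·φP_Σ)`). Inputs otherwise identical: `Σ` finite, `X^Σ` torsion [CTL], members `N_m` with
`Λ`-isomorphisms `X^Σ/p^m ≅ N_m/p^m` [(b)+Lemma 2.1], `N_m torsion → Ch(N_m)·R₀⟦T⟧ ⊆ (L_m)` [(2.5)_m,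
FW21 4.41 at `p ∥ N`, PREPRINT], `P_Σ ≠ 0`, `Ch(X^∅)·(P_Σ) ⊆ Ch(X^Σ)`. Output: `Ch_Λ(X^∅)·R₀⟦T⟧ ⊆ (L)`.
At SPLIT `p` this is the form whose (c) is delivered by print in either reading of [Cas20, Thm. 2.11]
at the `p`-new point (§2). CONDITIONAL on the displayed inputs.
[cite: Castella2018Erratum, proof of Thm. 1.1 (p. 4), read one-sidedly]
[cite: Skinner2016PacificMC, §3.1 (p. 192)] [cite: Castella2018, (4.1), p. 11 L9–11] -/
theorem AcSelmer.XAc.charIdeal_map_toUnr_le_span_of_oneSided_congruences_le (hS : S.Finite)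
    (hT : Module.IsTorsion (IwasawaAlgebra p) (XAc E p κ 𝔭 S γ))
    (N : ℕ → Type) [∀ m, AddCommGroup (N m)] [∀ m, Module (IwasawaAlgebra p) (N m)]
    [∀ m, Module.Finite (IwasawaAlgebra p) (N m)] (LS : UnrSeries p) (Lm : ℕ → UnrSeries p)
    (e : ∀ m : ℕ, 1 ≤ m →
      ((XAc E p κ 𝔭 S γ ⧸ ((Ideal.span {(PowerSeries.C (p : ℤ_[p]) : IwasawaAlgebra p)}) ^ m •
          (⊤ : Submodule (IwasawaAlgebra p) (XAc E p κ 𝔭 S γ)))) ≃ₗ[IwasawaAlgebra p]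
        (N m ⧸ ((Ideal.span {(PowerSeries.C (p : ℤ_[p]) : IwasawaAlgebra p)}) ^ m •
          (⊤ : Submodule (IwasawaAlgebra p) (N m))))))
    (hF : ∀ m : ℕ, 1 ≤ m → Module.IsTorsion (IwasawaAlgebra p) (N m) →
      (Module.charIdeal (IwasawaAlgebra p) (N m)).map (PowerSeries.map (toUnr p)) ≤
        Ideal.span {Lm m})
    (hc : ∀ m : ℕ, 1 ≤ m →
      Ideal.span {Lm m} ≤
        Ideal.span {LS} ⊔ (Ideal.span {(PowerSeries.C ((p : ℕ) : unrIntegers p) : UnrSeries p)}) ^ m)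
    {PS : IwasawaAlgebra p} (hPS : PS ≠ 0)
    (hX : XAc.charIdeal E p κ 𝔭 ∅ γ * Ideal.span {PS} ≤ XAc.charIdeal E p κ 𝔭 S γ)
    {L : UnrSeries p} (hLS : L * PowerSeries.map (toUnr p) PS ∣ LS) :
    (XAc.charIdeal E p κ 𝔭 ∅ γ).map (PowerSeries.map (toUnr p)) ≤ Ideal.span {L} := by
  set φ : IwasawaAlgebra p →+* UnrSeries p := PowerSeries.map (toUnr p) with hφ
  haveI : Module.Finite (IwasawaAlgebra p) (XAc E p κ 𝔭 S γ) := XAc.module_finite κ 𝔭 S γ hS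
  haveI := HidaLimitAlgebra.isNoetherianRing_unrSeries (p := p)
  haveI := HidaLimitAlgebra.isDiscreteValuationRing_unrIntegers (p := p)
  have hI : (Ideal.span {(PowerSeries.C (p : ℤ_[p]) : IwasawaAlgebra p)}).map φ ≤
      (⊥ : Ideal (UnrSeries p)).jacobson := by
    rw [hφ, HidaLimitAlgebra.map_span_C_p]
    exact HidaLimitAlgebra.span_C_p_le_jacobson_unrSeries
  have hc' : ∀ m : ℕ, 1 ≤ m → Ideal.span {Lm m} ≤ Ideal.span {LS} ⊔
      ((Ideal.span {(PowerSeries.C (p : ℤ_[p]) : IwasawaAlgebra p)}).map φ) ^ m := by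
    intro m hm
    rw [hφ, HidaLimitAlgebra.map_span_C_p]
    exact hc m hm
  have hF' : ∀ m : ℕ, 1 ≤ m →
      (Module.fittingIdeal (IwasawaAlgebra p) (N m) 0).map φ ≤ Ideal.span {Lm m} := by
    intro m hm
    by_cases hNt : Module.IsTorsion (IwasawaAlgebra p) (N m)
    · exact HidaLimitAlgebra.map_fittingIdeal_le_of_map_charIdeal_le _ hNt (hF m hm hNt)
    · have h0 : Module.fittingIdeal (IwasawaAlgebra p) (N m) 0 = ⊥ :=
        le_bot_iff.mp (Module.fittingIdeal_zero_le_annihilator.trans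
          (Module.annihilator_eq_bot_of_not_isTorsion hNt).le)
      rw [h0, Ideal.map_bot]
      exact bot_le
  have key : (Module.fittingIdeal (IwasawaAlgebra p) (XAc E p κ 𝔭 S γ) 0).map φ ≤
      Ideal.span {LS} :=
    CongruenceLe.map_le_span_of_oneSided_congruences_le φ
      (Ideal.span {(PowerSeries.C (p : ℤ_[p]) : IwasawaAlgebra p)}) N hI
      (le_refl (Module.fittingIdeal (IwasawaAlgebra p) (XAc E p κ 𝔭 S γ) 0)) LS Lm e hF' hc'
  exact AcSelmer.XAc.charIdeal_map_toUnr_le_span_of_map_fittingIdeal_le E p κ 𝔭 γ hS hT key hPS hX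
    hLS

/-- **Nothing is lost**: imc24c's equality-typed inputs `(L_m) + (p)^m = (L^Σ) + (p)^m` and
`(L^Σ) = (L·φP_Σ)` imply the one-sided ones used above. [folklore] -/
theorem AcSelmer.XAc.oneSided_inputs_of_eq {LS L : UnrSeries p} {PS : IwasawaAlgebra p}
    {Lm : ℕ → UnrSeries p}
    (hc : ∀ m : ℕ, 1 ≤ m →
      Ideal.span {Lm m} ⊔ (Ideal.span {(PowerSeries.C ((p : ℕ) : unrIntegers p) : UnrSeries p)}) ^ m =
        Ideal.span {LS} ⊔ (Ideal.span {(PowerSeries.C ((p : ℕ) : unrIntegers p) : UnrSeries p)}) ^ m)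
    (hLS : Ideal.span {LS} = Ideal.span {L * PowerSeries.map (toUnr p) PS}) :
    (∀ m : ℕ, 1 ≤ m → Ideal.span {Lm m} ≤
      Ideal.span {LS} ⊔ (Ideal.span {(PowerSeries.C ((p : ℕ) : unrIntegers p) : UnrSeries p)}) ^ m) ∧
    L * PowerSeries.map (toUnr p) PS ∣ LS :=
  ⟨fun m hm ↦ CongruenceLe.span_singleton_le_sup_of_eq (hc m hm),
    (Ideal.span_singleton_eq_span_singleton.mp hLS).symm.dvd⟩

end XAc

end Summit.BirchSwinnertonDyer.Rank1Residual.X11b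

end
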